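import Literature.InformationTheory.QuantumCodes.SmallSetFlipFailure
import Literature.InformationTheory.QuantumCodes.QuantumExpanderCodeParameters
import HarnessLib

/-!
# The threshold theorem for the small-set-flip decoder of quantum expander codes (FGL18 Thm 1, `β`-version)

Index of sources: `[cite: FawziGrospellierLeverrier2018]` = Fawzi–Grospellier–Leverrier, "Efficient decoding of
random errors for quantum expander codes", STOC 2018 / arXiv:1711.08351v2 (Thm 1, §3: Props 11, 12, 15, Thm 17);
`[cite: LeverrierTillichZemor2015]` = Leverrier–Tillich–Zémor, FOCS 2015 / arXiv:1504.00822 (the codes, §2–3).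

qec PARTITION v2 row 04 (`prover-qec-type-04`), item 04.FGL1, step 4 of 4: the ASSEMBLY. For the quantum expander
code of a `(Δ_A, Δ_B)`-biregular (`1 ≤ Δ_A ≤ Δ_B`), `(γ_A, δ_A, γ_B, δ_B)`-left-right-expanding graph with `β₀ > 0`
(`betaZero`), and ANY small-set-flip decoder with threshold `β₀Δ_B` (Algorithm 2, any tie-breaking;
`IsSSFDecoder (betaZero … * dB)`), the `X`-failure probability under a locally stochastic error of parameter
`p < p₀` is at most `C n (p/p₀)^{C'√n}`, `n = n_A² + n_B²` — the printed Theorem 1 with the decoder of Def 10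
("we will prove Theorem 1 for the version (β = β₀) of the algorithm"), i.e. the tree's named fact
`FGL18_theorem1_le` with `IsSSFDecoder 0` replaced by `IsSSFDecoder (betaZero dA dB δA δB * dB)`:
`fgl18_theorem1_beta`, PROVED, constants `p₀ = (4Δ²)^{-1/α}`, `C = 2`, `C' = α r β₀ m / (2(1+β₀))` with
`Δ = 2Δ_B(Δ_A+Δ_B)`, `α = β₀Δ_B/(β₀Δ_B + Δ_B)`, `r = Δ_A/Δ_B`, `m = min(γ_A, γ_B r)` (cruder than the printed
`p_ls` of Thm 17 — the statement only asks for SOME `p₀, C, C'`).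

Ingredients (all in the tree): Prop 11 (`QuantumExpander.FGL18_proposition11_le_holds`), upgraded here to single
runs (`add_runOutput_mem_rowSpace_of_le`, by freezing a decoder on one syndrome); the generic reduction
"failure ⇒ `α`-percolation" (`SmallSetFlip.sum_not_corrects_le_geometric`, from Props 12/15 and the Peierls form of
Thm 17); the adjacency graph `𝒢 = checkGraph (fromRows H_X H_Z)` of the code and its degree
(`degree_checkGraph_fromRows_le`: `≤ 2Δ_B(Δ_A+Δ_B−1)` from row weights `Δ_A+Δ_B` and column weights `≤ Δ_B`);
and the size relations `n_AΔ_A = n_BΔ_B` of a biregular graph. The typed fact `FGL18_theorem1(_le)` itself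
(threshold `κ = 0`, Algorithm 1) rests on FGL Remark 9 (no printed proof) and is NOT discharged here.
-/

namespace Literature.InformationTheory.QuantumCodes

namespace QuantumExpander

open Finset Matrix Literature.Probability.LatticeModels

/-! ### Degrees of the adjacency graph `𝒢` of a quantum expander code -/

section Degrees

variable {A B : Type*} [Fintype A] [Fintype B] [DecidableEq A] [DecidableEq B]

/-- **Column weights of `H_X`**: every qubit lies in at most `max(Δ_A, Δ_B) = Δ_B` `X`-checks (`Δ_A ≤ Δ_B`).
[cite: LeverrierTillichZemor2015, proof of Lemma 10 ("the syndrome σ_X(e) has weight at most Δ_B|e|"; arXiv v1 p0009 L64)] -/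
theorem card_col_expanderHX_le (H : Matrix B A (ZMod 2)) {dA dB : ℕ} (hreg : IsBiregular H dA dB)
    (hle : dA ≤ dB) (q : (A × A) ⊕ (B × B)) :
    (univ.filter fun c : A × B => expanderHX H c q ≠ 0).card ≤ dB := by
  classical
  rcases q with ⟨α, a'⟩ | ⟨b', β'⟩
  · have hsub : (univ.filter fun c : A × B => expanderHX H c (Sum.inl (α, a')) ≠ 0)
        ⊆ (nbrs H a').image fun β => (α, β) := by
      rintro ⟨α'', β⟩ hc
      rw [Finset.mem_filter] at hc
      have h := hc.2
      simp only [expanderHX, HypergraphProduct.zMatrix_apply_inl, Matrix.transpose_apply] at h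
      have hαα : α'' = α := by
        by_contra hne; exact h (by simp [hne])
      subst hαα
      have hβ : H β a' ≠ 0 := by
        intro h0; exact h (by simp [h0])
      exact Finset.mem_image.2 ⟨β, mem_nbrs.2 hβ, rfl⟩
    calc _ ≤ ((nbrs H a').image fun β => (α, β)).card := Finset.card_le_card hsub
      _ ≤ (nbrs H a').card := Finset.card_image_le
      _ = dA := card_nbrs_eq H hreg a'
      _ ≤ dB := hle
  · have hsub : (univ.filter fun c : A × B => expanderHX H c (Sum.inr (b', β')) ≠ 0)
        ⊆ (nbrs Hᵀ b').image fun α => (α, β') := by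
      rintro ⟨α, β''⟩ hc
      rw [Finset.mem_filter] at hc
      have h := hc.2
      simp only [expanderHX, HypergraphProduct.zMatrix_apply_inr] at h
      have hββ : β'' = β' := by
        by_contra hne; exact h (by simp [hne])
      subst hββ
      have hα : H b' α ≠ 0 := by
        intro h0; exact h (by simp [h0])
      exact Finset.mem_image.2 ⟨α, by rw [mem_nbrs, Matrix.transpose_apply]; exact hα, rfl⟩
    calc _ ≤ ((nbrs Hᵀ b').image fun α => (α, β')).card := Finset.card_le_card hsub
      _ ≤ (nbrs Hᵀ b').card := Finset.card_image_le
      _ = dB := card_nbrs_transpose_eq H hreg b'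

/-- **Column weights of `H_Z`**: every qubit lies in at most `max(Δ_A, Δ_B) = Δ_B` `Z`-generators (`Δ_A ≤ Δ_B`).
[cite: LeverrierTillichZemor2015, §3 (the code is LDPC with generator weights Δ_A+Δ_B and qubit degrees ≤ 2 max(Δ_A,Δ_B); arXiv v1 p0006)] -/
theorem card_col_expanderHZ_le (H : Matrix B A (ZMod 2)) {dA dB : ℕ} (hreg : IsBiregular H dA dB)
    (hle : dA ≤ dB) (q : (A × A) ⊕ (B × B)) :
    (univ.filter fun g : B × A => expanderHZ H g q ≠ 0).card ≤ dB := by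
  classical
  rcases q with ⟨α, a'⟩ | ⟨b', β'⟩
  · have hsub : (univ.filter fun g : B × A => expanderHZ H g (Sum.inl (α, a')) ≠ 0)
        ⊆ (nbrs H α).image fun b => (b, a') := by
      rintro ⟨b, a⟩ hg
      rw [Finset.mem_filter] at hg
      have h := hg.2
      rw [expanderHZ_row_apply_inl] at h
      have haa : a = a' := by
        by_contra hne; exact h (by simp [hne])
      have hb : H b α ≠ 0 := by
        intro h0; exact h (by simp [h0])
      rw [haa]
      exact Finset.mem_image.2 ⟨b, mem_nbrs.2 hb, rfl⟩
    calc _ ≤ ((nbrs H α).image fun b => (b, a')).card := Finset.card_le_card hsub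
      _ ≤ (nbrs H α).card := Finset.card_image_le
      _ = dA := card_nbrs_eq H hreg α
      _ ≤ dB := hle
  · have hsub : (univ.filter fun g : B × A => expanderHZ H g (Sum.inr (b', β')) ≠ 0)
        ⊆ (nbrs Hᵀ β').image fun a => (b', a) := by
      rintro ⟨b, a⟩ hg
      rw [Finset.mem_filter] at hg
      have h := hg.2
      rw [expanderHZ_row_apply_inr] at h
      have hbb : b = b' := by
        by_contra hne; exact h (by simp [hne])
      have ha : H β' a ≠ 0 := by
        intro h0; exact h (by simp [h0])
      rw [hbb]
      exact Finset.mem_image.2 ⟨a, by rw [mem_nbrs, Matrix.transpose_apply]; exact ha, rfl⟩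
    calc _ ≤ ((nbrs Hᵀ β').image fun a => (b', a)).card := Finset.card_le_card hsub
      _ ≤ (nbrs Hᵀ β').card := Finset.card_image_le
      _ = dB := card_nbrs_transpose_eq H hreg β'

/-- **Row weights of the stacked matrix `(H_X; H_Z)`**: every check / generator has weight `≤ Δ_A + Δ_B`.
[cite: LeverrierTillichZemor2015, Thm 1 (ii) ("row weights of H_X and H_Z equal Δ_A + Δ_B"; arXiv v1 p0006)] -/
theorem card_row_fromRows_le (H : Matrix B A (ZMod 2)) {dA dB : ℕ} (hreg : IsBiregular H dA dB)
    (i : (A × B) ⊕ (B × A)) :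
    (univ.filter fun q => Matrix.fromRows (expanderHX H) (expanderHZ H) i q ≠ 0).card ≤ dA + dB := by
  rcases i with ⟨α, β⟩ | ⟨b, a⟩
  · have h := hammingNorm_expanderHX_row_le H hreg α β
    simpa [hammingNorm, Matrix.fromRows_apply_inl] using h
  · have h := hammingNorm_expanderHZ_row_le H hreg b a
    simpa [hammingNorm, Matrix.fromRows_apply_inr] using h

/-- **Column weights of the stacked matrix `(H_X; H_Z)`**: every qubit lies in at most `2Δ_B` checks + generators
(`Δ_A ≤ Δ_B`). [cite: LeverrierTillichZemor2015, §3 (qubit degrees of the quantum expander code; arXiv v1 p0006)] -/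
theorem card_col_fromRows_le (H : Matrix B A (ZMod 2)) {dA dB : ℕ} (hreg : IsBiregular H dA dB) (hle : dA ≤ dB)
    (q : (A × A) ⊕ (B × B)) :
    (univ.filter fun i : (A × B) ⊕ (B × A) => Matrix.fromRows (expanderHX H) (expanderHZ H) i q ≠ 0).card
      ≤ 2 * dB := by
  classical
  have hsub : (univ.filter fun i : (A × B) ⊕ (B × A) => Matrix.fromRows (expanderHX H) (expanderHZ H) i q ≠ 0)
      ⊆ (univ.filter fun c : A × B => expanderHX H c q ≠ 0).map Function.Embedding.inl
        ∪ (univ.filter fun g : B × A => expanderHZ H g q ≠ 0).map Function.Embedding.inr := by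
    intro i hi
    rw [Finset.mem_filter] at hi
    rcases i with c | g
    · rw [Matrix.fromRows_apply_inl] at hi
      exact Finset.mem_union_left _
        (Finset.mem_map_of_mem _ (Finset.mem_filter.2 ⟨Finset.mem_univ _, hi.2⟩))
    · rw [Matrix.fromRows_apply_inr] at hi
      exact Finset.mem_union_right _
        (Finset.mem_map_of_mem _ (Finset.mem_filter.2 ⟨Finset.mem_univ _, hi.2⟩))
  calc _ ≤ _ := Finset.card_le_card hsub
    _ ≤ ((univ.filter fun c : A × B => expanderHX H c q ≠ 0).map Function.Embedding.inl).card
          + ((univ.filter fun g : B × A => expanderHZ H g q ≠ 0).map Function.Embedding.inr).card :=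
        Finset.card_union_le _ _
    _ ≤ dB + dB := by
        rw [Finset.card_map, Finset.card_map]
        exact Nat.add_le_add (card_col_expanderHX_le H hreg hle q) (card_col_expanderHZ_le H hreg hle q)
    _ = 2 * dB := (two_mul dB).symm

/-- **Degree of the adjacency graph `𝒢`** of a quantum expander code (two qubits adjacent iff they share an
`X`-check or a `Z`-generator — the tree's `checkGraph` of the stacked matrix): `deg ≤ 2Δ_B(Δ_A + Δ_B − 1)`.
[cite: FawziGrospellierLeverrier2018, §2.4 ("𝒢 has degree upper bounded by some constant d which depends on the weights of the generators and the qubit degrees"; arXiv v2 p0008)] -/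
theorem degree_checkGraph_fromRows_le (H : Matrix B A (ZMod 2)) {dA dB : ℕ} (hreg : IsBiregular H dA dB)
    (hle : dA ≤ dB) [DecidableRel (checkGraph (Matrix.fromRows (expanderHX H) (expanderHZ H))).Adj]
    (q : (A × A) ⊕ (B × B)) :
    (checkGraph (Matrix.fromRows (expanderHX H) (expanderHZ H))).degree q ≤ 2 * dB * (dA + dB - 1) :=
  degree_checkGraph_le _ (card_row_fromRows_le H hreg) (card_col_fromRows_le H hreg hle) q

omit [Fintype A] [Fintype B] in
/-- Two distinct qubits sharing an `X`-check are adjacent in `𝒢`. [cite: FawziGrospellierLeverrier2018, §2.4 (definition of 𝒢)] -/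
theorem checkGraph_fromRows_adj_of_X (H : Matrix B A (ZMod 2)) (c : A × B) (q q' : (A × A) ⊕ (B × B))
    (hne : q ≠ q') (h1 : expanderHX H c q ≠ 0) (h2 : expanderHX H c q' ≠ 0) :
    (checkGraph (Matrix.fromRows (expanderHX H) (expanderHZ H))).Adj q q' :=
  ⟨hne, Sum.inl c, by rw [Matrix.fromRows_apply_inl, Matrix.fromRows_apply_inl]; exact ⟨h1, h2⟩⟩

omit [Fintype A] [Fintype B] in
/-- Two distinct qubits sharing a `Z`-generator are adjacent in `𝒢`. [cite: FawziGrospellierLeverrier2018, §2.4 (definition of 𝒢)] -/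
theorem checkGraph_fromRows_adj_of_Z (H : Matrix B A (ZMod 2)) (g : B × A) (q q' : (A × A) ⊕ (B × B))
    (hne : q ≠ q') (h1 : expanderHZ H g q ≠ 0) (h2 : expanderHZ H g q' ≠ 0) :
    (checkGraph (Matrix.fromRows (expanderHX H) (expanderHZ H))).Adj q q' :=
  ⟨hne, Sum.inr g, by rw [Matrix.fromRows_apply_inr, Matrix.fromRows_apply_inr]; exact ⟨h1, h2⟩⟩

end Degrees

/-! ### Proposition 11 for single runs -/

section Runs

variable {A B : Type} [Fintype A] [Fintype B] [DecidableEq A] [DecidableEq B]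

/-- **FGL18 Prop 11, run form**: EVERY complete valid run of Algorithm 2 (threshold `β₀Δ_B`) from `σ_X(e)` with
`|e| ≤ (rβ₀/(1+β₀)) min(γ_A n_A, γ_B n_B)` ends with `e ⊕ Ê ∈ C_Z^⊥` (apply the decoder form
`FGL18_proposition11_le_holds` to a small-set-flip decoder frozen to this run on the syndrome `σ_X(e)` — "any
non-deterministic choice of the Fᵢ"). [cite: FawziGrospellierLeverrier2018, Prop 11 (§3.2, arXiv v2 p0011; "the algorithm … is not deterministic")] -/
theorem add_runOutput_mem_rowSpace_of_le (H : Matrix B A (ZMod 2)) {dA dB : ℕ} {γA δA γB δB : ℝ}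
    (hreg : IsBiregular H dA dB) (hexp : IsLeftRightExpanding H dA dB γA δA γB δB)
    (hdA : 0 < dA) (hdB : 0 < dB) (hle : dA ≤ dB) (hγA : 0 < γA) (hδA : 0 < δA) (hγB : 0 < γB)
    (hδB : 0 < δB) (hβ : 0 < betaZero dA dB δA δB)
    {e : (A × A) ⊕ (B × B) → ZMod 2} {l : List (Finset ((A × A) ⊕ (B × B)))}
    (hrun : IsSSFRun (betaZero dA dB δA δB * dB) (expanderHX H) (expanderHZ H) (expanderHX H *ᵥ e) l)
    (he : (hammingNorm e : ℝ) ≤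
      ((dA : ℝ) / dB) * betaZero dA dB δA δB / (1 + betaZero dA dB δA δB) *
        min (γA * Fintype.card A) (γB * Fintype.card B)) :
    e + runOutput l ∈ rowSpace (expanderHZ H) := by
  classical
  obtain ⟨D₀, hD₀⟩ := exists_isSSFDecoder (betaZero dA dB δA δB * dB) (expanderHX H) (expanderHZ H)
  set D : Decoder (A × B → ZMod 2) ((A × A) ⊕ (B × B) → ZMod 2) :=
    fun σ => if σ = expanderHX H *ᵥ e then runOutput l else D₀ σ with hDdef
  have hD : IsSSFDecoder (betaZero dA dB δA δB * dB) (expanderHX H) (expanderHZ H) D := by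
    intro σ
    by_cases hσ : σ = expanderHX H *ᵥ e
    · refine ⟨l, hσ ▸ hrun, ?_⟩
      simp [hDdef, hσ]
    · obtain ⟨l', h1, h2⟩ := hD₀ σ
      exact ⟨l', h1, by simp [hDdef, hσ, h2]⟩
  have hc := FGL18_proposition11_le_holds A B H dA dB γA δA γB δB hreg hexp hdA hdB hle hγA hδA hγB hδB hβ
    D hD e he
  have hDe : D (expanderHX H *ᵥ e) = runOutput l := by simp [hDdef]
  change D (expanderHX H *ᵥ e) + e ∈ (rowSpace (expanderHZ H) : Set _) at hc
  rw [hDe, add_comm] at hc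
  exact hc

end Runs

/-! ### Size relations -/

section Sizes

/-- `√(n_A² + n_B²) ≤ 2 n_A` when `n_B ≤ n_A`. [folklore] -/
private theorem sqrt_sq_add_sq_le {x y : ℝ} (hx : 0 ≤ x) (hy : 0 ≤ y) (hyx : y ≤ x) :
    Real.sqrt (x ^ 2 + y ^ 2) ≤ 2 * x := by
  rw [show (2 : ℝ) * x = Real.sqrt ((2 * x) ^ 2) by rw [Real.sqrt_sq (by positivity)]]
  exact Real.sqrt_le_sqrt (by nlinarith)

/-- For a biregular graph (`n_AΔ_A = n_BΔ_B`), `min(γ_A, γ_B Δ_A/Δ_B) · n_A ≤ min(γ_A n_A, γ_B n_B)`. [folklore] -/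
private theorem min_mul_le_min {nA nB dA dB γA γB : ℝ} (hnA : 0 ≤ nA) (hdB : 0 < dB)
    (hAB : nA * dA = nB * dB) :
    min γA (γB * dA / dB) * nA ≤ min (γA * nA) (γB * nB) := by
  refine le_min ?_ ?_
  · exact mul_le_mul_of_nonneg_right (min_le_left _ _) hnA
  · have h : γB * dA / dB * nA = γB * nB := by
      rw [div_mul_eq_mul_div, div_eq_iff hdB.ne']
      calc γB * dA * nA = γB * (nA * dA) := by ring
        _ = γB * (nB * dB) := by rw [hAB]
        _ = γB * nB * dB := by ring
    calc min γA (γB * dA / dB) * nA ≤ γB * dA / dB * nA :=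
          mul_le_mul_of_nonneg_right (min_le_right _ _) hnA
      _ = γB * nB := h

end Sizes

/-! ### The threshold theorem -/

section Threshold

open Classical in
/-- **Fawzi–Grospellier–Leverrier 2018, Theorem 1 — PROVED for the `β = β₀` version of the decoder (Def 10 /
Algorithm 2; "we will prove Theorem 1 for the version (β = β₀) of the algorithm")**: for `(Δ_A, Δ_B)`-biregular
(`1 ≤ Δ_A ≤ Δ_B`), `(γ_A, δ_A, γ_B, δ_B)`-left-right-expanding graphs with `β₀ > 0` there are constants
`p₀ > 0`, `C`, `C' > 0` such that for EVERY such graph, EVERY small-set-flip decoder with threshold `β₀Δ_B` (any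
tie-breaking) and EVERY locally stochastic `X`-error weight of parameter `p < p₀`, the total weight of the
uncorrected error patterns is `≤ C (n_A² + n_B²) (p/p₀)^{C' √(n_A² + n_B²)}` (`n_A² + n_B² = n`, the block length).
This is `FGL18_theorem1_le` with `IsSSFDecoder 0` (Algorithm 1) replaced by `IsSSFDecoder (β₀Δ_B)` (Algorithm 2);
the transfer to Algorithm 1 is the unproved printed Remark 9. Constants: `p₀ = (4Δ²)^{-1/α}`, `C = 2`,
`C' = α (rβ₀/(1+β₀)) min(γ_A, γ_B r)/2`, `Δ = 2Δ_B(Δ_A+Δ_B)`, `α = β₀Δ_B/(β₀Δ_B+Δ_B)`, `r = Δ_A/Δ_B`.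
Proof: failure ⇒ `MaxConn_α(E) ≥ ⌊t₀⌋+1` with `t₀` the radius of Prop 11 (`SmallSetFlip.sum_not_corrects_le_geometric`
with `𝒢 = checkGraph (H_X; H_Z)`, degree `≤ Δ`), and `(2Δ²p^α)^{t} ≤ (p/p₀)^{αt} ≤ (p/p₀)^{C'√n}` as `t > t₀ ≥ C'√n/α`.
[cite: FawziGrospellierLeverrier2018, Thm 1 (§1, arXiv v2 p0004) and its proof (§3.3, p0012)] -/
theorem fgl18_theorem1_beta :
    ∀ (dA dB : ℕ) (γA δA γB δB : ℝ), 0 < dA → 0 < dB → dA ≤ dB → 0 < γA → 0 < δA → 0 < γB → 0 < δB →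
      0 < betaZero dA dB δA δB →
      ∃ (p₀ C C' : ℝ), 0 < p₀ ∧ 0 < C' ∧
        ∀ (A B : Type) [Fintype A] [Fintype B] [DecidableEq A] [DecidableEq B]
          (H : Matrix B A (ZMod 2)),
          IsBiregular H dA dB → IsLeftRightExpanding H dA dB γA δA γB δB →
          ∀ D : Decoder (A × B → ZMod 2) ((A × A) ⊕ (B × B) → ZMod 2),
            IsSSFDecoder (betaZero dA dB δA δB * dB) (expanderHX H) (expanderHZ H) D →
            ∀ (p : ℝ) (μ : Finset ((A × A) ⊕ (B × B)) → ℝ), 0 ≤ p → p < p₀ →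
              IsLocallyStochastic μ p →
              (∑ E ∈ univ.filter (fun E : Finset ((A × A) ⊕ (B × B)) =>
                  ¬ D.Corrects (fun x => expanderHX H *ᵥ x) (rowSpace (expanderHZ H) : Set _)
                    (flipVec E)), μ E) ≤
                C * ((Fintype.card A : ℝ) ^ 2 + (Fintype.card B : ℝ) ^ 2) *
                  (p / p₀) ^ (C' * Real.sqrt ((Fintype.card A : ℝ) ^ 2 + (Fintype.card B : ℝ) ^ 2)) := by
  intro dA dB γA δA γB δB hdA hdB hle hγA hδA hγB hδB hβ
  -- the constants
  set β : ℝ := betaZero dA dB δA δB with hβdef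
  set κ : ℝ := β * dB with hκdef
  set α : ℝ := κ / (κ + dB) with hαdef
  set Δ : ℕ := 2 * dB * (dA + dB) with hΔdef
  set c₀ : ℝ := (dA : ℝ) / dB * β / (1 + β) with hc₀def
  set m : ℝ := min γA (γB * dA / dB) with hmdef
  set p₀ : ℝ := (4 * (Δ : ℝ) ^ 2) ^ (-(1 / α)) with hp₀def
  set C' : ℝ := α * c₀ * m / 2 with hC'def
  have hdA' : (0 : ℝ) < dA := by exact_mod_cast hdA
  have hdB' : (0 : ℝ) < dB := by exact_mod_cast hdB
  have hκ : 0 < κ := mul_pos hβ hdB'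
  have hα : 0 < α := div_pos hκ (by linarith)
  have hΔ1 : 1 ≤ Δ := Nat.mul_pos (Nat.mul_pos two_pos hdB) (Nat.add_pos_left hdA dB)
  have hΔ1' : (1 : ℝ) ≤ Δ := by exact_mod_cast hΔ1
  have hΔsq : (1 : ℝ) ≤ (Δ : ℝ) ^ 2 := one_le_pow₀ hΔ1'
  have h4Δ : (1 : ℝ) ≤ 4 * (Δ : ℝ) ^ 2 := by linarith
  have h4Δpos : (0 : ℝ) < 4 * (Δ : ℝ) ^ 2 := by linarith
  have hp₀pos : 0 < p₀ := Real.rpow_pos_of_pos h4Δpos _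
  have hp₀le : p₀ ≤ 1 :=
    Real.rpow_le_one_of_one_le_of_nonpos h4Δ (neg_nonpos.2 (le_of_lt (div_pos one_pos hα)))
  -- `p₀^α = 1/(4Δ²)`
  have hαne : α ≠ 0 := hα.ne'
  have hp₀α : p₀ ^ α = (4 * (Δ : ℝ) ^ 2)⁻¹ := by
    rw [hp₀def, ← Real.rpow_mul h4Δpos.le, show -(1 / α) * α = -1 by field_simp, Real.rpow_neg_one]
  have hc₀ : 0 < c₀ := by
    rw [hc₀def]; exact div_pos (mul_pos (div_pos hdA' hdB') hβ) (by linarith)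
  have hm : 0 < m := lt_min hγA (div_pos (mul_pos hγB hdA') hdB')
  have hC' : 0 < C' := by
    rw [hC'def]; exact div_pos (mul_pos (mul_pos hα hc₀) hm) two_pos
  refine ⟨p₀, 2, C', hp₀pos, hC', ?_⟩
  intro A B _ _ _ _ H hreg hexp D hD p μ hp0 hpp₀ hμ
  classical
  -- sizes
  set nA : ℝ := (Fintype.card A : ℝ) with hnAdef
  set nB : ℝ := (Fintype.card B : ℝ) with hnBdef
  have hnA : 0 ≤ nA := Nat.cast_nonneg _
  have hnB : 0 ≤ nB := Nat.cast_nonneg _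
  have hAB : nA * dA = nB * dB := by
    rw [hnAdef, hnBdef]; exact_mod_cast card_mul_eq_card_mul_of_isBiregular H hreg
  have hBA : nB ≤ nA := by
    have h : nB * dB ≤ nA * dB := by
      rw [← hAB]; exact mul_le_mul_of_nonneg_left (by exact_mod_cast hle) hnA
    exact le_of_mul_le_mul_right h hdB'
  have hV : (Fintype.card ((A × A) ⊕ (B × B)) : ℝ) = nA ^ 2 + nB ^ 2 := by
    rw [card_qubits]; push_cast; rw [hnAdef, hnBdef]
  -- the radius of Prop 11 and the resulting cluster size
  set t₀ : ℝ := c₀ * min (γA * nA) (γB * nB) with ht₀def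
  have ht₀ : 0 ≤ t₀ := mul_nonneg hc₀.le (le_min (mul_nonneg hγA.le hnA) (mul_nonneg hγB.le hnB))
  -- the graph `𝒢` and the hypotheses of the generic reduction
  set G := checkGraph (Matrix.fromRows (expanderHX H) (expanderHZ H)) with hGdef
  have hGX : ∀ c q q', q ≠ q' → expanderHX H c q ≠ 0 → expanderHX H c q' ≠ 0 → G.Adj q q' :=
    fun c q q' hne h1 h2 => checkGraph_fromRows_adj_of_X H c q q' hne h1 h2
  have hGZ : ∀ g q q', q ≠ q' → expanderHZ H g q ≠ 0 → expanderHZ H g q' ≠ 0 → G.Adj q q' :=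
    fun g q q' hne h1 h2 => checkGraph_fromRows_adj_of_Z H g q q' hne h1 h2
  have hw : ∀ v : (A × A) ⊕ (B × B) → ZMod 2,
      (hammingNorm (expanderHX H *ᵥ v) : ℝ) ≤ (dB : ℝ) * hammingNorm v := fun v => by
    exact_mod_cast hammingNorm_expanderHX_mulVec_le H hreg hle v
  have hcorr : ∀ (E' : Finset ((A × A) ⊕ (B × B))) (l' : List (Finset ((A × A) ⊕ (B × B)))),
      IsSSFRun κ (expanderHX H) (expanderHZ H) (expanderHX H *ᵥ flipVec E') l' →
      ((E'.card : ℝ) ≤ t₀) → flipVec E' + runOutput l' ∈ rowSpace (expanderHZ H) := by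
    intro E' l' hrun hE'
    refine add_runOutput_mem_rowSpace_of_le H hreg hexp hdA hdB hle hγA hδA hγB hδB hβ hrun ?_
    rw [hammingNorm_flipVec]
    exact hE'.trans_eq (by rw [ht₀def, hc₀def])
  have hdeg : ∀ x, G.degree x ≤ Δ := by
    intro x
    refine (degree_checkGraph_fromRows_le H hreg hle x).trans ?_
    rw [hΔdef]
    exact Nat.mul_le_mul_left _ (Nat.sub_le _ _)
  -- `2Δ²p^α < 1/2`
  have hp1 : p ≤ 1 := (hpp₀.le).trans hp₀le
  have hpα : p ^ α < p₀ ^ α := Real.rpow_lt_rpow hp0 hpp₀ hα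
  set ρ : ℝ := 2 * (Δ : ℝ) ^ 2 * p ^ α with hρdef
  have hΔ2pos : (0 : ℝ) < 2 * (Δ : ℝ) ^ 2 := by linarith
  have hρ0 : 0 ≤ ρ := by rw [hρdef]; exact mul_nonneg hΔ2pos.le (Real.rpow_nonneg hp0 α)
  have hρhalf : ρ < 1 / 2 := by
    have h : ρ < 2 * (Δ : ℝ) ^ 2 * p₀ ^ α := by
      rw [hρdef]; exact mul_lt_mul_of_pos_left hpα hΔ2pos
    rw [hp₀α] at h
    have hΔne : (Δ : ℝ) ^ 2 ≠ 0 := by positivity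
    have h' : 2 * (Δ : ℝ) ^ 2 * (4 * (Δ : ℝ) ^ 2)⁻¹ = 1 / 2 := by
      field_simp; ring
    linarith [h'.le, h'.ge]
  have hρ1 : ρ < 1 := by linarith
  -- `ρ = (p/p₀)^α / 2 ≤ (p/p₀)^α`
  set x : ℝ := p / p₀ with hxdef
  have hx0 : 0 ≤ x := div_nonneg hp0 hp₀pos.le
  have hx1 : x ≤ 1 := (div_le_one hp₀pos).2 hpp₀.le
  have hxα : x ^ α = 4 * (Δ : ℝ) ^ 2 * p ^ α := by
    rw [hxdef, Real.div_rpow hp0 hp₀pos.le, hp₀α, div_inv_eq_mul, mul_comm]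
  have hρx : ρ ≤ x ^ α := by
    have h := hρ0
    rw [hρdef] at h
    rw [hxα, hρdef]
    linarith
  -- the generic bound
  have hgen := SmallSetFlip.sum_not_corrects_le_geometric (G := G) hGX hGZ hκ hdB'.le hw ht₀ hcorr hD hdeg hΔ1
    hμ hp0 hp1 (by rw [← hαdef, ← hρdef]; exact hρ1)
  rw [← hαdef, ← hρdef, hV] at hgen
  -- simplify the geometric bound: `≤ 2 n ρ^t`
  set t : ℕ := ⌊t₀⌋₊ + 1 with htdef
  have hn0 : 0 ≤ nA ^ 2 + nB ^ 2 := by positivity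
  have hstep1 : (nA ^ 2 + nB ^ 2) * ρ ^ t / ((Δ : ℝ) ^ 2 * (1 - ρ)) ≤ 2 * (nA ^ 2 + nB ^ 2) * ρ ^ t := by
    have hden : (1 : ℝ) / 2 ≤ (Δ : ℝ) ^ 2 * (1 - ρ) := by
      calc (1 : ℝ) / 2 = 1 * (1 / 2) := by norm_num
        _ ≤ (Δ : ℝ) ^ 2 * (1 - ρ) := mul_le_mul hΔsq (by linarith) (by norm_num) (by positivity)
    calc (nA ^ 2 + nB ^ 2) * ρ ^ t / ((Δ : ℝ) ^ 2 * (1 - ρ))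
        ≤ (nA ^ 2 + nB ^ 2) * ρ ^ t / (1 / 2) :=
          div_le_div_of_nonneg_left (mul_nonneg hn0 (pow_nonneg hρ0 t)) (by norm_num) hden
      _ = 2 * (nA ^ 2 + nB ^ 2) * ρ ^ t := by ring
  -- `ρ^t ≤ x^{αt} ≤ x^{C'√n}`
  have hstep2 : ρ ^ t ≤ x ^ (α * t) := by
    calc ρ ^ t ≤ (x ^ α) ^ t := pow_le_pow_left₀ hρ0 hρx t
      _ = x ^ (α * t) := by rw [Real.rpow_mul hx0, Real.rpow_natCast]
  have hexpo : C' * Real.sqrt (nA ^ 2 + nB ^ 2) ≤ α * t := by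
    have hs : Real.sqrt (nA ^ 2 + nB ^ 2) ≤ 2 * nA := sqrt_sq_add_sq_le hnA hnB hBA
    have hmin : m * nA ≤ min (γA * nA) (γB * nB) := min_mul_le_min hnA hdB' hAB
    have htt : t₀ < (t : ℝ) := by
      rw [htdef]; push_cast; exact Nat.lt_floor_add_one t₀
    calc C' * Real.sqrt (nA ^ 2 + nB ^ 2) ≤ C' * (2 * nA) := mul_le_mul_of_nonneg_left hs hC'.le
      _ = α * (c₀ * (m * nA)) := by rw [hC'def]; ring
      _ ≤ α * (c₀ * min (γA * nA) (γB * nB)) :=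
          mul_le_mul_of_nonneg_left (mul_le_mul_of_nonneg_left hmin hc₀.le) hα.le
      _ = α * t₀ := by rw [ht₀def]
      _ ≤ α * t := mul_le_mul_of_nonneg_left htt.le hα.le
  have hstep3 : x ^ (α * t) ≤ x ^ (C' * Real.sqrt (nA ^ 2 + nB ^ 2)) := by
    rcases hx0.eq_or_lt with hx00 | hxpos
    · -- `p = 0`: the left-hand side vanishes
      have htpos : (0 : ℝ) < t := by rw [htdef]; positivity
      rw [← hx00, Real.zero_rpow (mul_pos hα htpos).ne']
      exact Real.rpow_nonneg le_rfl _
    · exact Real.rpow_le_rpow_of_exponent_ge hxpos hx1 hexpo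
  -- assemble
  calc _ ≤ (nA ^ 2 + nB ^ 2) * ρ ^ t / ((Δ : ℝ) ^ 2 * (1 - ρ)) := hgen
    _ ≤ 2 * (nA ^ 2 + nB ^ 2) * ρ ^ t := hstep1
    _ ≤ 2 * (nA ^ 2 + nB ^ 2) * x ^ (C' * Real.sqrt (nA ^ 2 + nB ^ 2)) :=
        mul_le_mul_of_nonneg_left (hstep2.trans hstep3) (by positivity)

end Threshold

end QuantumExpander

end Literature.InformationTheory.QuantumCodes
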